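import Summits.BirchSwinnertonDyer.BirchSwinnertonDyer.Theorems.CMKolyvaginAtInertTwoExactTwinTamagawaAtTwo
import Summits.BirchSwinnertonDyer.BirchSwinnertonDyer.Theorems.CMKolyvaginAtInertTwoCMExactDescentAtTwo
import Summits.BirchSwinnertonDyer.BirchSwinnertonDyer.Theorems.CMKolyvaginAtInertTwoCMPrimitiveSupplyAtInertTwoOfKolyvaginConjecture
import HarnessLib

/-!
# Route `CMKolyvaginAtInertTwo` (leaf `WAllCornerFTwo`, habitat H₂): THE LEVEL-ZERO ONE-BIT CLASS THEOREM FROM PRINT —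
# `BSD₂(E)` for every `E ∈ H₂` with a Heegner field of one-bit genus defect (`Σ ≤ 1`) whose Heegner point `y_K` is `2`-indivisible,
# modulo the route's printed inputs ONLY (GZ, GZK, modularity, Milne, Burungale–Flach, Gross 1991 Prop. 3.7 (2))

Seat `bsd-line-cmk2-p1` g21 (cell `bsd-print-cf2`), `--supports stmt-BirchSwinnertonDyer-24277` (helper; closes nothing by name — a class
aside is the pen's call).  THEOREMS ONLY (no definition, no named fact, no `sorry`).  BSD is NOT proved by this: a CONDITIONAL class theorem.

g9's `CMLevelZeroTwo.bsdp_two_of_levelZero_primeHeegner_of_printedInputs_of_plumbing` booked the H₂ level-zero class for PRIME Heegner fields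
modulo prints + two plumbing binders + two cite-only statements (h53, hGZ31).  Since then the line's kernel road has been rebuilt (g13–g20: the
pair method over `ℚ`, the level-`2` swap engine, the Ш-valued ladders; g21: null places), so that the exactness crux 24277 holds on `Σ ≤ 1`
modulo the four prints + Gross 3.7 (2) (`KolyvaginLowerTwo.card_primaryComponent_sha_two_baseChange_eq_pow_of_certificate_of_sum_defect_le_one_
of_printedInputs`).  At LEVEL ZERO the crux's certificate is the Heegner point itself (`n = 1`, `d = d₁`, `M₀ = 0`): no Kolyvagin conjecture
is needed.  Composing with g0's exact descent (`CMExactDescent.cmExactDescentAtTwo_of_facts`, item 22837 mod prints) and Burungale–Flach for the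
rank-`0` CM twin (`Rank1Residual.bsdp_cm_rankZero`; twin from `CMSupply.exists_minimal_twin_hasCM_analyticRank_zero`, `L(E^{(d_K)},1) ≠ 0` by
Gross–Zagier since `y_K` is non-torsion):

* **`bsdp_two_of_levelZero_of_sum_defect_le_one_of_printedInputs`** — for `W ∈ H₂` (globally minimal, `HasCM`, `CMInert W 2`, `ρ̄_{E,2}` onto,
  `r_an = 1`, odd Tamagawa product), `K` imaginary quadratic with odd `d_K ≠ −3`, Heegner for `N_E`, `Σ ≤ 1`; a frame `Dt` (lattice clause,
  `Odd Dt.c`), `β`, `ι`, `d₁` with `y_K = P(1)` of infinite order and `y_K ∉ 2E(K[1])`: the six prints ⟹ **`BSDp W 2`**.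
  No plumbing binder, no `h53` / `hGZ31`, no primality of `|d_K|` (one-bit defect suffices; `Σ = 1` for prime `|d_K|`, g15).
* `bsdp_two_of_levelZero_of_twin_tamagawa_of_printedInputs` — the same with the one-bit condition in Tamagawa currency
  («`¬ 4 ∣ ∏ c(Wd)`» for some equation `Wd` of the twist).

HONEST FRAMING: conditional on SIX statement-only prints (`gross_zagier` all levels 24148, `rank_eq_analyticRank_of_analyticRank_le_one` 19921,
`exists_isNewformOf` (⟹ `hasEntireLFunction_rat` 19273), `Milne1972.bsdQuotient_baseChange_quadratic_anyModel` 24149,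
`bsdTriple_of_hasCM_of_L_one_ne_zero` 19423, `GrossLMS1991.prop37_2_reductionCongruence_inert N_E W K`); everything else (Kolyvagin's `#Ш`-control at
`p = 2` on the CM-inert habitat, upper AND lower, the `2`-descent, Milne bookkeeping) is kernel.  The STATEMENT — BSD₂ for CM curves at an INERT
`2` from a `2`-primitive Heegner point over a Heegner field that may have `2` INERT (when `2 ∤ N_E`) — has no printed counterpart
(Kolyvagin/McCallum/Matar–Nekovář: `p` odd; Kriz–Li's (★)-door needs `2` split in `K`; barrier `CMRankOneAtNonsplitTwo`); the referee decides the
label at booking.  BSD is NOT proved by this; no summit statement and no item is closed by this file.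

References: [McCallumLMS1991] §5 Thm. 5.4; [Kolyvagin1991MathAnn] Thm. 2.2; [GrossLMS1991] §2 Conj. (2.2), Prop. 3.7 (2); [GrossZagier1986] I.6.3,
V.§2; [Milne1972ArithmeticAV] Thm. 1; [BurungaleFlach2024] Thm. 1.1, Cor. 2; [Kramer1981] Prop. 3.
-/

set_option autoImplicit false
-- the Theorems namespace of this sub repeats the summit name by design (D-0017 nested layout)
set_option linter.dupNamespace false

noncomputable section

open scoped Classical

open WeierstrassCurve NumberField Literature.NumberTheory.EllipticCurves
  Literature.NumberTheory.EllipticCurves.ModularForms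
  Literature.NumberTheory.EllipticCurves.Rank1Residual
  Literature.NumberTheory.EllipticCurves.Rank1Residual.Typed
  Literature.NumberTheory.EllipticCurves.KrizLi2019
  Summit.BirchSwinnertonDyer.Rank1Residual
open Literature.NumberTheory.EllipticCurves.GrossLMS1991 (prop37_2_reductionCongruence_inert)
open Summit.BirchSwinnertonDyer.BirchSwinnertonDyer.Theorems.CMExactDescent

namespace Summit.BirchSwinnertonDyer.BirchSwinnertonDyer.Theorems.KolyvaginLowerTwo

/-- **THE LEVEL-ZERO ONE-BIT CLASS THEOREM.**  `W ∈ H₂` (globally minimal, CM, `2` inert in the CM field, `ρ̄_{E,2}` onto, `r_an(E) = 1`, odd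
Tamagawa product); `K` imaginary quadratic, `d_K` odd `≠ −3`, Heegner for `N_E`, genus defect `Σ ≤ 1`; a frame `Dt` (lattice clause, odd Manin
constant), `β`, `ι`, `d₁` with `y_K = P(1)` of infinite order and `2`-INDIVISIBLE in `E(K[1])`.  THEN `BSDp W 2`, modulo GZ (all levels), GZK,
modularity, Milne any-model, Burungale–Flach and Gross 1991 Prop. 3.7 (2).  Proof: the crux's certificate is `(n, d) = (1, d₁)` with `M₀ = 0`, so
`#Ш(E_K)(2) = 1` (`card_…_eq_pow_of_certificate_of_sum_defect_le_one_of_printedInputs`); the twin `E^{(d_K)}` has `L ≠ 0` (Gross–Zagier), a globally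
minimal CM model of analytic rank `0` (`CMSupply.exists_minimal_twin_hasCM_analyticRank_zero`) with `BSD₂` (Burungale–Flach, `bsdp_cm_rankZero`);
g0's exact descent concludes. [cite: McCallumLMS1991, §5 Thm. 5.4] [cite: GrossZagier1986, V.§2] [cite: Milne1972ArithmeticAV, Thm. 1]
[cite: BurungaleFlach2024, Thm. 1.1 and Cor. 2] [cite: GrossLMS1991, Prop. 3.7 (2)] -/
theorem bsdp_two_of_levelZero_of_sum_defect_le_one_of_printedInputs
    (hGZ : ∀ (N : ℕ) [NeZero N] (W : WeierstrassCurve ℚ) (K : Type) [Field K] [NumberField K], gross_zagier N W K)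
    (hGZK : rank_eq_analyticRank_of_analyticRank_le_one) (hnf : exists_isNewformOf)
    (hMilneC : Milne1972.bsdQuotient_baseChange_quadratic_anyModel) (hBF : bsdTriple_of_hasCM_of_L_one_ne_zero)
    (W : WeierstrassCurve ℚ) [W.IsElliptic] [W.IsGloballyMinimal] [NeZero (W.conductorNorm ℤ)]
    (hCM : W.HasCM) (hin : Rank1Residual.CMInert W 2) (hρ2 : W.HasSurjectiveModNGaloisRep 2) (hr : W.analyticRank = 1)
    (hT : Odd W.tamagawaProduct) (K : Type) [Field K] [NumberField K] (hIQ : IsImaginaryQuadratic K)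
    (hodd : Odd (NumberField.discr K)) (h3 : NumberField.discr K ≠ -3) (hHe : SatisfiesHeegnerHypothesis (W.conductorNorm ℤ) K)
    (hdef : ∑ q ∈ (NumberField.discr K).natAbs.primeFactors,
        ((if jacobiSym W.Δ.num q = -1 then 1 else 0) +
          (if jacobiSym W.Δ.num q = 1 ∧ Even (W.frobeniusTrace q) then 2 else 0)) ≤ 1)
    (h37 : prop37_2_reductionCongruence_inert (W.conductorNorm ℤ) W K)
    (Dt : ModularParametrizationData W (W.conductorNorm ℤ))
    (hopt : ∀ z ∈ Dt.L.lattice, ∃ w ∈ periodLattice Dt.f, z = (Dt.c : ℂ) * w) (hc : Odd Dt.c)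
    (β : ℤ) (ι : K →+* ℂ) (d₁ : KolyvaginHeegnerData Dt β ι 1) (hy : ¬ IsOfFinAddOrder d₁.derivedPoint)
    (hprim : ¬ ∃ Q : (W.baseChange (ringClassField K ι 1)).toAffine.Point, (2 : ℤ) • Q = d₁.derivedPoint) :
    BSDp W 2 := by
  have hmod : hasEntireLFunction_rat := hasEntireLFunction_rat_of_exists_isNewformOf hnf
  -- the certificate at level zero: `(n, d) = (1, d₁)`, `M₀ = 0`
  have hM₀ : ∃ Q : (W.baseChange (ringClassField K ι 1)).toAffine.Point, ((2 ^ 0 : ℕ) : ℤ) • Q = d₁.derivedPoint :=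
    ⟨d₁.derivedPoint, by rw [pow_zero, Nat.cast_one, one_smul]⟩
  have hndiv : ¬ ∃ Q : (W.baseChange (ringClassField K ι 1)).toAffine.Point, ((2 ^ (0 + 1) : ℕ) : ℤ) • Q = d₁.derivedPoint := by
    rw [zero_add, pow_one]
    exact_mod_cast hprim
  have hKoly : ∀ ℓ ∈ (1 : ℕ).primeFactors, Zhang2014.IsKolyvaginPrime (W.conductorNorm ℤ) W K 2 ℓ ∧ Rank1Residual.CMInert W ℓ := by
    intro ℓ hℓ
    rw [Nat.primeFactors_one] at hℓ
    exact absurd hℓ (Finset.notMem_empty ℓ)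
  have hsha : Nat.card (AddCommGroup.primaryComponent (W.baseChange K).sha 2) = 2 ^ (2 * 0) :=
    card_primaryComponent_sha_two_baseChange_eq_pow_of_certificate_of_sum_defect_le_one_of_printedInputs hGZ hGZK hmod hMilneC W hCM hin hρ2 hT
      K hIQ hodd h3 hHe hdef h37 Dt β ι d₁ hy 0 hM₀ hndiv d₁ squarefree_one hKoly hprim
  -- the twin: `L(E^{(d_K)}, 1) ≠ 0` by Gross–Zagier, a globally minimal CM model of analytic rank `0`, BSD₂ by Burungale–Flach
  obtain ⟨P₀, Hd, hP₀, hP₀K⟩ := exists_heegnerPoint_map_eq_derivedPoint_one hIQ hHe d₁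
  have hPinf : ¬ IsOfFinAddOrder P₀ := by
    intro hfin
    apply hy
    rw [← hP₀K]
    exact (WeierstrassCurve.Affine.Point.map (W' := W) (algebraMap K (ringClassField K ι 1)).toRatAlgHom).isOfFinAddOrder hfin
  have hLK : LDerivEK W K ≠ 0 :=
    (lDerivEK_ne_zero_iff_not_isOfFinAddOrder W (W.conductorNorm ℤ) K (hGZ _ W K) hIQ hHe ⟨Dt, Hd, ι, hP₀⟩).mpr hPinf
  have hL0 : W.entireLFunction 1 = 0 := entireLFunction_one_eq_zero_of_analyticRank_eq_one hr
  have hLt : (W.quadraticTwist (NumberField.discr K : ℚ)).entireLFunction 1 ≠ 0 := by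
    intro h0
    apply hLK
    rw [lDerivEK_eq_deriv_mul W K hmod hL0, h0, mul_zero]
  obtain ⟨Wd, _, _, hWd, hcmd, hrd⟩ := CMSupply.exists_minimal_twin_hasCM_analyticRank_zero hnf W hCM K hLt
  have hBd : BSDp Wd 2 := Rank1Residual.bsdp_cm_rankZero (p := 2) hBF hmod hcmd hrd
  -- g0's exact descent
  exact cmExactDescentAtTwo_of_facts hGZ hGZK hmod hMilneC W hCM hin hρ2 hr hT K hIQ hodd h3 hHe Dt hopt hc β ι d₁ hy 0 hM₀ hndiv hsha Wd
    hWd hBd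

/-- **The level-zero class theorem with the one-bit condition in Tamagawa currency**: the same, with `Σ ≤ 1` replaced by an equation `Wd'` of the
twist `E^{(d_K)}` whose Tamagawa product is not divisible by `4` (`sum_defect_le_one_of_not_four_dvd_tamagawaProduct_twin`).
[cite: Kramer1981, Prop. 3] [cite: McCallumLMS1991, §5 Thm. 5.4] [cite: BurungaleFlach2024, Thm. 1.1 and Cor. 2] -/
theorem bsdp_two_of_levelZero_of_twin_tamagawa_of_printedInputs
    (hGZ : ∀ (N : ℕ) [NeZero N] (W : WeierstrassCurve ℚ) (K : Type) [Field K] [NumberField K], gross_zagier N W K)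
    (hGZK : rank_eq_analyticRank_of_analyticRank_le_one) (hnf : exists_isNewformOf)
    (hMilneC : Milne1972.bsdQuotient_baseChange_quadratic_anyModel) (hBF : bsdTriple_of_hasCM_of_L_one_ne_zero)
    (W : WeierstrassCurve ℚ) [W.IsElliptic] [W.IsGloballyMinimal] [NeZero (W.conductorNorm ℤ)]
    (hCM : W.HasCM) (hin : Rank1Residual.CMInert W 2) (hρ2 : W.HasSurjectiveModNGaloisRep 2) (hr : W.analyticRank = 1)
    (hT : Odd W.tamagawaProduct) (K : Type) [Field K] [NumberField K] (hIQ : IsImaginaryQuadratic K)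
    (hodd : Odd (NumberField.discr K)) (h3 : NumberField.discr K ≠ -3) (hHe : SatisfiesHeegnerHypothesis (W.conductorNorm ℤ) K)
    {Wd' : WeierstrassCurve ℚ} [Wd'.IsElliptic] (hWd' : ∃ C : VariableChange ℚ, C • W.quadraticTwist (NumberField.discr K : ℚ) = Wd')
    (h4 : ¬ 4 ∣ Wd'.tamagawaProduct)
    (h37 : prop37_2_reductionCongruence_inert (W.conductorNorm ℤ) W K)
    (Dt : ModularParametrizationData W (W.conductorNorm ℤ))
    (hopt : ∀ z ∈ Dt.L.lattice, ∃ w ∈ periodLattice Dt.f, z = (Dt.c : ℂ) * w) (hc : Odd Dt.c)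
    (β : ℤ) (ι : K →+* ℂ) (d₁ : KolyvaginHeegnerData Dt β ι 1) (hy : ¬ IsOfFinAddOrder d₁.derivedPoint)
    (hprim : ¬ ∃ Q : (W.baseChange (ringClassField K ι 1)).toAffine.Point, (2 : ℤ) • Q = d₁.derivedPoint) :
    BSDp W 2 :=
  bsdp_two_of_levelZero_of_sum_defect_le_one_of_printedInputs hGZ hGZK hnf hMilneC hBF W hCM hin hρ2 hr hT K hIQ hodd h3 hHe
    (sum_defect_le_one_of_not_four_dvd_tamagawaProduct_twin W hT hIQ hodd hHe hWd' h4) h37 Dt hopt hc β ι d₁ hy hprim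

end Summit.BirchSwinnertonDyer.BirchSwinnertonDyer.Theorems.KolyvaginLowerTwo

end
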